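import Summits.BirchSwinnertonDyer.BirchSwinnertonDyer.Theorems.AlignedTransportAtTwoMainConjectureTransportAlignedAtTwoKilfordCopyRankTwo
import Literature.NumberTheory.EllipticCurves.PeriodHomologyIsotypicRankTwo
import Literature.NumberTheory.EllipticCurves.PAdicLFunctionProofs
import HarnessLib

/-!
# Crux C1 `MainConjectureTransportAlignedAtTwo` (stmt-BirchSwinnertonDyer-22296), line `birth`, residual (R2) `stub_lamLawKilford` (Kilford stratum):
# RANK TWO, BOTH HALVES — `finrank_ℤ Λ[I_f] = 2` for the newform of an elliptic curve; the named fact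
# `finrank_isotypic_periodHomologyHecke_eq_two` (att-p3 g16, p682676) DISCHARGED (width seat att-p4 g16; `--supports 22296`)

THEOREMS ONLY (no `def`, no `sorry`, no named fact); UNCONDITIONAL. BSD is not proved by this; C1 is not closed by this;
`stub_lamLawKilford` is NOT discharged by this.

The upper half `finrank ≤ 2` is this seat's `…KilfordCopyRankTwo.finrank_isotypic_le_two` (p683323: perfect Hecke-self-adjoint pairing +
Eichler–Shimura basis + multiplicity one). This file adds the LOWER half and the equality:

* `exists_pair_linearIndependent_isotypic` — two `ℤ`-independent elements of `Λ[I_f]` (`Λ = periodHomologyHecke N`, `I_f = heckeAnnihilator f`)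
  for `f` the newform of a curve: with `Λ_f = ℤω₁ + ℤω₂` (tree theorem `periodLattice_eq_closure_pair_holds`) spanning `ℂ` over `ℝ`
  (`periodLattice_span_eq_top`), the two `ℤ`-valued coordinate functionals `x ↦ [x(f)]_{ωᵢ}` on `Λ` are, by PERFECTNESS of the pairing `B`
  (`ip_of_crossingPairing_flagSides`), of the form `B(xᵢ, ·)`; self-adjointness gives `I_f · xᵢ = 0` (`B(t xᵢ, y) = B(xᵢ, t y) = [y(t f)] = 0`), and
  evaluating at preimages of `ω₁, ω₂` gives independence.
* `two_le_finrank_isotypic`, **`finrank_isotypic_eq_two`** (`Module.finrank ℤ ((Submodule.torsionBySet 𝕋_ℤ Λ I_f).restrictScalars ℤ) = 2`), and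
  **`finrank_isotypic_periodHomologyHecke_eq_two_holds : finrank_isotypic_periodHomologyHecke_eq_two`** — the Literature named fact of
  `Literature/NumberTheory/EllipticCurves/PeriodHomologyIsotypicRankTwo.lean` (Diamond–Shurman Prop. 6.6.4 / DDT Lemma 1.34 form) PROVED; it lives here
  and not under `Literature/` because the pairing theorem it rests on is a `Summits` theorem (cell bsd-wall). Consumers: att-p3 g16's
  `…KilfordCopyOfCopyAlignment.lamLawKilford_of_conductorNorm_eq_of_copyAlignment_of_facts hΩu hmod hJ₀ hR2 hCA hM2` with `hR2 := finrank_isotypic_periodHomologyHecke_eq_two_holds`.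

References: Darmon–Diamond–Taylor 1995 §1.6 Lemma 1.34, Lemma 1.38, §1.7 [DarmonDiamondTaylor1995]; Diamond–Shurman 2005 Prop. 6.6.4 [DiamondShurman2005];
Cremona 1997 §2.8, §2.10 (2.10.1)–(2.10.2) [CremonaAlgorithms1997]; Shimura 1971 Thm. 7.14 [Shimura1971].
-/

noncomputable section

-- justification: the `Summit.BirchSwinnertonDyer.BirchSwinnertonDyer.…` path repeats a component (route-file convention)
set_option linter.dupNamespace false
set_option autoImplicit false

open scoped MatrixGroups ModularForm NumberField Classical
open CongruenceSubgroup Complex Module Submodule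
open Literature.NumberTheory.EllipticCurves Literature.NumberTheory.EllipticCurves.ModularForms
open Summit.BirchSwinnertonDyer.Rank1Residual.F1Sign2
open Summit.BirchSwinnertonDyer.BirchSwinnertonDyer.Theorems.ThetaLayerLambdaCongruenceAtTwo
open Summit.BirchSwinnertonDyer.BirchSwinnertonDyer.Theorems.AlignedTransportAtTwoKilfordCopyRankTwo

namespace Summit.BirchSwinnertonDyer.BirchSwinnertonDyer.Theorems.AlignedTransportAtTwoKilfordCopyRankTwoEq

variable {N : ℕ} [NeZero N]

/-! ## §1 Two independent elements of `Λ[I_f]` -/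

/-- **Two `ℤ`-independent elements of `Λ[I_f]`.** For `f` the newform of an elliptic curve `W` there are `x₁, x₂ ∈ Λ = H₁(X₀(N);ℤ)` killed by
`I_f = heckeAnnihilator f` and `ℤ`-linearly independent: the `B`-preimages (perfect Hecke-self-adjoint pairing) of the two coordinate functionals of
`x ↦ x(f) ∈ Λ_f = ℤω₁ ⊕ ℤω₂`. [cite: DarmonDiamondTaylor1995, §1.6 Lemma 1.34 and Lemma 1.38] [cite: CremonaAlgorithms1997, §2.10 (2.10.1)–(2.10.2)] -/
theorem exists_pair_linearIndependent_isotypic {W : WeierstrassCurve ℚ} {f : CuspForm (Gamma0 N) 2} (hf : IsNewformOf W f) :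
    ∃ v : Fin 2 → periodHomologyHecke N, LinearIndependent ℤ v ∧ ∀ j, ∀ t ∈ heckeAnnihilator f, t • v j = 0 := by
  -- the pairing
  obtain ⟨B, hB, hadj⟩ := ip_of_crossingPairing_flagSides N
  -- `Λ_f = ℤω₁ + ℤω₂`, spanning `ℂ` over `ℝ`; the real basis `Ω = (ω₁, ω₂)` of `ℂ`
  obtain ⟨ω₁, ω₂, hΛf⟩ := periodLattice_eq_closure_pair_holds (f := f) hf.1 hf.coeffField_eq_bot
  have hspanΛ : Submodule.span ℝ (periodLattice f : Set ℂ) = ⊤ := periodLattice_span_eq_top _ hf.1.ne_zero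
  obtain ⟨Ω, hΩ⟩ : ∃ Ω : Fin 2 → ℂ, Ω = ![ω₁, ω₂] := ⟨_, rfl⟩
  have hΩ0 : Ω 0 = ω₁ := by rw [hΩ]; rfl
  have hΩ1 : Ω 1 = ω₂ := by rw [hΩ]; rfl
  have hrange : Set.range Ω = {ω₁, ω₂} := by
    rw [hΩ, Matrix.range_cons, Matrix.range_cons, Matrix.range_empty, Set.union_empty, Set.singleton_union]
  have hspanΩ : ⊤ ≤ Submodule.span ℝ (Set.range Ω) := by
    rw [← hspanΛ, Submodule.span_le, hΛf, hrange]
    intro z hz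
    obtain ⟨m, n, rfl⟩ := AddSubgroup.mem_closure_pair.mp hz
    exact Submodule.add_mem _ (Submodule.smul_of_tower_mem _ m (Submodule.subset_span (by simp)))
      (Submodule.smul_of_tower_mem _ n (Submodule.subset_span (by simp)))
  have hcard : Fintype.card (Fin 2) = finrank ℝ ℂ := by rw [Fintype.card_fin, Complex.finrank_real_complex]
  have hli : LinearIndependent ℝ Ω := linearIndependent_of_top_le_span_of_card_eq_finrank hspanΩ hcard
  obtain ⟨bΩ, hbΩ⟩ : ∃ b : Module.Basis (Fin 2) ℝ ℂ, ∀ i, b i = Ω i :=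
    ⟨Module.Basis.mk hli hspanΩ, fun i ↦ Module.Basis.mk_apply hli hspanΩ i⟩
  -- periods of `Λ` lie in `Λ_f`, hence have INTEGER `Ω`-coordinates
  have hperiod : ∀ x : periodHomologyHecke N, (x : Module.Dual ℂ (CuspForm (Gamma0 N) 2)) f ∈ periodLattice f := fun x ↦ by
    rw [periodLattice_eq_map_periodHomology]
    exact ⟨x, (mem_periodHomologyHecke N).mp x.2, rfl⟩
  have hint : ∀ (i : Fin 2) (x : periodHomologyHecke N), ∃ z : ℤ, bΩ.repr ((x : Module.Dual ℂ (CuspForm (Gamma0 N) 2)) f) i = (z : ℝ) := by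
    intro i x
    have hx := hperiod x
    rw [hΛf] at hx
    obtain ⟨m, n, hmn⟩ := AddSubgroup.mem_closure_pair.mp hx
    rw [← hmn, ← hΩ0, ← hΩ1, ← hbΩ 0, ← hbΩ 1, map_add, map_zsmul, map_zsmul, bΩ.repr_self, bΩ.repr_self]
    fin_cases i
    · exact ⟨m, by simp⟩
    · exact ⟨n, by simp⟩
  -- the two integer-valued coordinate functionals `hᵢ : Λ →+ ℤ`
  have hfun : ∀ i : Fin 2, ∃ h : periodHomologyHecke N →+ ℤ,
      ∀ x : periodHomologyHecke N, (h x : ℝ) = bΩ.repr ((x : Module.Dual ℂ (CuspForm (Gamma0 N) 2)) f) i := by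
    intro i
    choose z hz using hint i
    refine ⟨{ toFun := z, map_zero' := ?_, map_add' := fun x y ↦ ?_ }, fun x ↦ (hz x).symm⟩
    · apply Int.cast_injective (α := ℝ)
      rw [← hz, ZeroMemClass.coe_zero, LinearMap.zero_apply, map_zero, Finsupp.zero_apply, Int.cast_zero]
    · apply Int.cast_injective (α := ℝ)
      rw [Int.cast_add, ← hz, ← hz, ← hz, Submodule.coe_add, LinearMap.add_apply, map_add, Finsupp.add_apply]
  choose h hh using hfun
  -- their `B`-preimages `xᵢ`
  choose x hx using fun i ↦ hB.2 (h i)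
  refine ⟨x, ?_, fun j t ht ↦ ?_⟩
  · -- independence: evaluate `B(s x₀ + t x₁, ·) = s h₀ + t h₁` at preimages of `ω₁, ω₂`
    have hpre : ∀ i : Fin 2, ∃ y : periodHomologyHecke N, (y : Module.Dual ℂ (CuspForm (Gamma0 N) 2)) f = Ω i := by
      intro i
      have hmem : Ω i ∈ periodLattice f := by
        rw [hΛf]
        refine AddSubgroup.subset_closure ?_
        rw [← hrange]; exact ⟨i, rfl⟩
      rw [periodLattice_eq_map_periodHomology] at hmem
      obtain ⟨φ, hφ, hφf⟩ := hmem
      exact ⟨⟨φ, (mem_periodHomologyHecke N).mpr hφ⟩, hφf⟩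
    choose y hy using hpre
    have hval : ∀ i j : Fin 2, h i (y j) = if j = i then 1 else 0 := by
      intro i j
      apply Int.cast_injective (α := ℝ)
      rw [hh, hy, ← hbΩ j, bΩ.repr_self, Finsupp.single_apply]
      split_ifs <;> simp
    have hx' : ∀ i j : Fin 2, B (x i) (y j) = if j = i then 1 else 0 := fun i j ↦ by rw [hx, hval]
    rw [show x = ![x 0, x 1] from by ext i; fin_cases i <;> rfl]
    refine LinearIndependent.pair_iff.mpr fun s t hst ↦ ?_
    have key : ∀ j : Fin 2, s * B (x 0) (y j) + t * B (x 1) (y j) = 0 := fun j ↦ by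
      have := congrArg (fun u : periodHomologyHecke N ↦ B.flip (y j) u) hst
      simpa only [map_add, map_zsmul, AddMonoidHom.flip_apply, zsmul_eq_mul, Int.cast_id, map_zero] using this
    have k0 := key 0
    have k1 := key 1
    simp only [hx', if_true, show (0 : Fin 2) ≠ 1 from by decide, show (1 : Fin 2) ≠ 0 from by decide, if_false,
      mul_one, mul_zero, add_zero, zero_add] at k0 k1
    exact ⟨k0, k1⟩
  · -- isotypic: `B(t • xⱼ, y) = B(xⱼ, t • y) = [y(t f)]ⱼ = 0`
    have hBt : B (t • x j) = 0 := by
      ext y'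
      rw [hadj, hx, AddMonoidHom.zero_apply]
      apply Int.cast_injective (α := ℝ)
      rw [hh, Submodule.coe_smul, HeckeRing0.smul_dual_apply, show HeckeRing0.toEnd N 2 t f = 0 from ht, map_zero, map_zero,
        Finsupp.zero_apply, Int.cast_zero]
    exact hB.1 (hBt.trans (map_zero B).symm)

/-! ## §2 `finrank = 2` and the named fact -/

/-- **`2 ≤ finrank_ℤ Λ[I_f]`** (`Λ[I_f] = (Submodule.torsionBySet 𝕋_ℤ Λ I_f).restrictScalars ℤ`). [cite: DarmonDiamondTaylor1995, §1.6 Lemma 1.34] -/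
theorem two_le_finrank_isotypic {W : WeierstrassCurve ℚ} {f : CuspForm (Gamma0 N) 2} (hf : IsNewformOf W f) :
    2 ≤ Module.finrank ℤ ((Submodule.torsionBySet (HeckeRing0 N 2) (periodHomologyHecke N)
      (heckeAnnihilator f : Set (HeckeRing0 N 2))).restrictScalars ℤ) := by
  obtain ⟨T, hT⟩ : ∃ T : Submodule ℤ (periodHomologyHecke N), T = (Submodule.torsionBySet (HeckeRing0 N 2) (periodHomologyHecke N)
      (heckeAnnihilator f : Set (HeckeRing0 N 2))).restrictScalars ℤ := ⟨_, rfl⟩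
  rw [← hT]
  haveI := moduleFinite_int_periodHomologyHecke N
  haveI : Module.Finite ℤ T := Module.Finite.of_injective T.subtype Subtype.coe_injective
  have hTmem : ∀ y : periodHomologyHecke N, y ∈ T ↔ ∀ t ∈ heckeAnnihilator f, t • y = 0 := fun y ↦ by
    rw [hT, Submodule.restrictScalars_mem, Submodule.mem_torsionBySet_iff]
    simp only [Subtype.forall, SetLike.mem_coe]
  obtain ⟨v, hv, hiso⟩ := exists_pair_linearIndependent_isotypic hf
  let v' : Fin 2 → T := fun j ↦ ⟨v j, (hTmem _).mpr (hiso j)⟩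
  have hv' : LinearIndependent ℤ v' := LinearIndependent.of_comp T.subtype (by exact hv)
  simpa using hv'.fintype_card_le_finrank

/-- **RANK2: `finrank_ℤ Λ[I_f] = 2`** for the newform `f` of an elliptic curve. [cite: DarmonDiamondTaylor1995, §1.6 Lemma 1.34]
[cite: DiamondShurman2005, Prop. 6.6.4] [cite: CremonaAlgorithms1997, §2.8] -/
theorem finrank_isotypic_eq_two {W : WeierstrassCurve ℚ} {f : CuspForm (Gamma0 N) 2} (hf : IsNewformOf W f) :
    Module.finrank ℤ ((Submodule.torsionBySet (HeckeRing0 N 2) (periodHomologyHecke N)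
      (heckeAnnihilator f : Set (HeckeRing0 N 2))).restrictScalars ℤ) = 2 :=
  le_antisymm (finrank_isotypic_le_two hf) (two_le_finrank_isotypic hf)

/-- **The named fact `finrank_isotypic_periodHomologyHecke_eq_two` (Diamond–Shurman Prop. 6.6.4 form, filed p682676) HOLDS** — proved from tree
theorems only (its torsion set `{t | t f = 0}` is `↑(heckeAnnihilator f)` by definition). [cite: DiamondShurman2005, Prop. 6.6.4]
[cite: DarmonDiamondTaylor1995, §1.6 Lemma 1.34 and Lemma 1.38] -/
theorem finrank_isotypic_periodHomologyHecke_eq_two_holds : finrank_isotypic_periodHomologyHecke_eq_two :=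
  fun _N _ _W _ _f hf ↦ finrank_isotypic_eq_two hf

end Summit.BirchSwinnertonDyer.BirchSwinnertonDyer.Theorems.AlignedTransportAtTwoKilfordCopyRankTwoEq

end
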